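import Summits.QuantumFields.GaugeBoot.ClassBRPClosure
import Summits.QuantumFields.GaugeBoot.WordSpaces
import Summits.QuantumFields.GaugeBoot.BootstrapFunctionals
import HarnessLib

/-!
# Reflection positivity from polynomial half-observables (gauge-boot, L1/L4 supplement)

HONEST FRAMING (cell `pub-gaugeboot`, page 1 of every file): the venture produces certified bounds
on lattice expectations at stated coupling, gauge group, dimension and torus size; NOT a mass gap,
NOT a continuum limit, NOT a string tension; NOT Yang–Mills-summit-bearing (barriers
`FixedCouplingUltralocality`, `PerturbativeInvisibility`). Structural; it certifies no number.

## Content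

A bootstrap functional sees only POLYNOMIAL observables, and its reflection-positivity cuts
(`BootstrapRPCutsZd`) are the REAL inequalities `0 ≤ φ ((F ∘ Θ) · F)` for `F` in the word spaces at
the half-space `S`. `ClassB.IsReflectionPositiveFor Θ S μ` asks `0 ≤ ∫ (F∘Θ)‾ F dμ` for every
bounded MEASURABLE COMPLEX `S`-supported `F`. For a probability measure `μ` invariant under an
involutive measurable `Θ`, the former (for the expectation functional) implies the latter:

* `restrictCM S`, `halfPolyAlgebra r S` (the algebra generated by the entries of the links of `S`;
  `= ⋃_n wordSpace r S n`, `exists_mem_wordSpace_of_mem_halfPolyAlgebra`),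
  `comp_restrictCM_mem_halfPolyAlgebra` (pullbacks of polynomials on the sub-configuration space
  `S → G` are half-polynomials);
* ★ `integral_comp_mul_self_nonneg_of_dependsOn` — DENSITY: if `0 ≤ ∫ (P∘Θ) P dμ` for all
  half-polynomials `P`, then `0 ≤ ∫ (A∘Θ) A dμ` for every CONTINUOUS real `A` depending only on the
  links of `S` (`A` factors through `S → G` via `setGlue`; Stone–Weierstrass `mem_closure_polyAlgebra`
  on the compact space `S → G`; the quadratic form is continuous in the sup norm);
* ★ `integral_comp_mul_symm` — for `Θ`-invariant `μ` and involutive `Θ` the form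
  `Q(A, B) = ∫ (A∘Θ) B dμ` is symmetric, so the complex form `∫ (F∘Θ)‾ F dμ` of `F = A + iB` has real
  part `Q(A,A) + Q(B,B)` and vanishing imaginary part;
* ★★★ `IsReflectionPositiveFor.of_wordSpace` — `μ` a probability measure, `Θ` measurable, measure
  preserving and involutive: RP on the real word spaces at `S` implies `IsReflectionPositiveFor Θ S μ`
  (via `IsReflectionPositiveFor.of_continuous_cylinder`). This is what lets the RP-cut bootstrap
  hierarchy converge to reflection-positive states (`RPBootstrapConvergenceZd`).

References: K. Osterwalder, E. Seiler, Ann. Phys. 110 (1978) 440, §2; J. Glimm, A. Jaffe, Quantum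
Physics (1987) §6.1. Folklore.
-/

noncomputable section

open MeasureTheory Filter Topology
open scoped ComplexOrder ComplexConjugate
open Literature.MathematicalPhysics.QuantumFieldTheory (LatticeRep)
open Literature.MathematicalPhysics.QuantumLattice

namespace Summit.QuantumFields.GaugeBoot

/-! ## The polynomial half-algebra and pullbacks from the sub-configuration space -/

section HalfAlgebra

variable {d : ℕ} {G : Type*} [Group G] [TopologicalSpace G] (r : LatticeRep G) (S : Set (ZdEdge d))

/-- The restriction of a configuration to the links of `S`, as a continuous map. -/
def restrictCM : C(LGConfig d G, ↥S → G) :=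
  ⟨S.restrict, continuous_pi fun e => continuous_apply (e : ZdEdge d)⟩

omit [Group G] in
/-- `restrictCM` evaluated. -/
@[simp] theorem restrictCM_apply (U : LGConfig d G) (e : ↥S) : restrictCM (G := G) S U e = U e := rfl

/-- **The polynomial half-algebra at `S`**: generated by the entries of the links of `S`. -/
def halfPolyAlgebra : Subalgebra ℝ C(LGConfig d G, ℝ) := Algebra.adjoin ℝ (entryGensOn r S)

/-- Every half-polynomial lies in a word space at `S`. -/
theorem exists_mem_wordSpace_of_mem_halfPolyAlgebra {x : C(LGConfig d G, ℝ)} (hx : x ∈ halfPolyAlgebra r S) :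
    ∃ n, x ∈ wordSpace r S n := by
  induction hx using Algebra.adjoin_induction with
  | mem x hx => exact ⟨1, mem_wordSpace_of_mem_entryGensOn r hx le_rfl⟩
  | algebraMap c => exact ⟨0, algebraMap_mem_wordSpace r S 0 c⟩
  | add x y _ _ hx hy =>
    obtain ⟨m, hm⟩ := hx
    obtain ⟨n, hn⟩ := hy
    exact ⟨max m n, (wordSpace r S (max m n)).add_mem (wordSpace_mono r subset_rfl (le_max_left _ _) hm)
      (wordSpace_mono r subset_rfl (le_max_right _ _) hn)⟩
  | mul x y _ _ hx hy =>
    obtain ⟨m, hm⟩ := hx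
    obtain ⟨n, hn⟩ := hy
    exact ⟨m + n, mul_mem_wordSpace r hm hn⟩

/-- Word-space elements are half-polynomials. -/
theorem mem_halfPolyAlgebra_of_mem_wordSpace {n : ℕ} {x : C(LGConfig d G, ℝ)} (hx : x ∈ wordSpace r S n) :
    x ∈ halfPolyAlgebra r S := by
  unfold wordSpace at hx
  refine (Submodule.span_le.2 ?_ : Submodule.span ℝ (wordsOn r S n) ≤ Subalgebra.toSubmodule (halfPolyAlgebra r S)) hx
  rintro w ⟨l, hl, -, rfl⟩
  exact Subalgebra.list_prod_mem _ fun y hy => Algebra.subset_adjoin (hl y hy)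

/-- **Pullbacks of polynomials on the sub-configuration space `S → G` are half-polynomials at `S`.** -/
theorem comp_restrictCM_mem_halfPolyAlgebra {p : C(↥S → G, ℝ)} (hp : p ∈ polyAlgebra (ι := ↥S) r) :
    p.comp (restrictCM (G := G) S) ∈ halfPolyAlgebra r S := by
  have h : (polyAlgebra (ι := ↥S) r).map (ContinuousMap.compRightAlgHom ℝ ℝ (restrictCM (G := G) S)) ≤
      halfPolyAlgebra r S := by
    unfold polyAlgebra halfPolyAlgebra
    rw [AlgHom.map_adjoin]
    refine Algebra.adjoin_mono ?_
    rintro _ ⟨x, hx, rfl⟩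
    rcases hx with ⟨⟨e, a, b⟩, rfl⟩ | ⟨⟨e, a, b⟩, rfl⟩
    · have hx : (ContinuousMap.compRightAlgHom ℝ ℝ (restrictCM (G := G) S)) (reEntry r e a b) =
          reEntry r (e : ZdEdge d) a b := by ext U; rfl
      rw [hx]
      exact reEntry_mem_entryGensOn e.2 a b
    · have hx : (ContinuousMap.compRightAlgHom ℝ ℝ (restrictCM (G := G) S)) (imEntry r e a b) =
          imEntry r (e : ZdEdge d) a b := by ext U; rfl
      rw [hx]
      exact imEntry_mem_entryGensOn e.2 a b
  exact h ⟨p, hp, rfl⟩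

omit [Group G] in
/-- Gluing along `S` is continuous in the `S`-part. -/
theorem continuous_setGlue (η : LGConfig d G) : Continuous fun V : ↥S → G => setGlue S V η := by
  classical
  refine continuous_pi fun e => ?_
  by_cases he : e ∈ S
  · simp only [setGlue, he, ↓reduceDIte]
    exact continuous_apply _
  · simp only [setGlue, he, ↓reduceDIte]
    exact continuous_const

omit [Group G] in
/-- **A continuous observable depending only on the links of `S` factors continuously through
`S → G`.** -/
theorem exists_comp_restrictCM_of_dependsOn [Nonempty G] {A : C(LGConfig d G, ℝ)} (hA : DependsOn A S) :
    ∃ g : C(↥S → G, ℝ), A = g.comp (restrictCM (G := G) S) := by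
  refine ⟨⟨fun V => A (setGlue S V fun _ => Classical.arbitrary G),
    A.continuous.comp (continuous_setGlue S _)⟩, ?_⟩
  ext U
  exact (apply_setGlue_restrict S hA (fun _ => Classical.arbitrary G) U).symm

end HalfAlgebra

/-! ## From polynomial RP to RP of continuous real half-observables (density) -/

section Density

variable {d : ℕ} {G : Type*} [Group G] [TopologicalSpace G] [IsTopologicalGroup G] [CompactSpace G]
  [MeasurableSpace G] [BorelSpace G] [SecondCountableTopology G] (r : LatticeRep G) {S : Set (ZdEdge d)}
  {μ : Measure (LGConfig d G)} [IsProbabilityMeasure μ]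

omit [Group G] [IsTopologicalGroup G] in
/-- The quadratic form `A ↦ ∫ (A ∘ Θ) A dμ` is continuous in the sup norm (`Θ` continuous). -/
theorem continuous_integral_comp_mul_self (ΘCM : C(LGConfig d G, LGConfig d G)) :
    Continuous fun A : C(LGConfig d G, ℝ) => ∫ U, A (ΘCM U) * A U ∂μ := by
  have h1 : Continuous fun A : C(LGConfig d G, ℝ) => A.comp ΘCM * A :=
    (ContinuousMap.continuous_precomp ΘCM).mul continuous_id
  exact (continuous_integral_continuousMap μ).comp h1

omit [IsTopologicalGroup G] in
/-- ★ **Density step.** If every half-polynomial `P` at `S` satisfies `0 ≤ ∫ (P ∘ Θ) P dμ`, then so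
does every CONTINUOUS real observable depending only on the links of `S` (it factors through the
compact space `S → G`, where polynomials are dense — `mem_closure_polyAlgebra`; the form is
continuous). [cite: OsterwalderSeiler1978, §2] -/
theorem integral_comp_mul_self_nonneg_of_dependsOn (ΘCM : C(LGConfig d G, LGConfig d G))
    (hpoly : ∀ n, ∀ P ∈ wordSpace r S n, 0 ≤ ∫ U, P (ΘCM U) * P U ∂μ)
    {A : C(LGConfig d G, ℝ)} (hA : DependsOn A S) : 0 ≤ ∫ U, A (ΘCM U) * A U ∂μ := by
  haveI : Nonempty G := ⟨1⟩
  obtain ⟨g, rfl⟩ := exists_comp_restrictCM_of_dependsOn S hA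
  have hclosed : IsClosed {f : C(LGConfig d G, ℝ) | 0 ≤ ∫ U, f (ΘCM U) * f U ∂μ} :=
    isClosed_le continuous_const (continuous_integral_comp_mul_self ΘCM)
  have hmem : g.comp (restrictCM (G := G) S) ∈
      closure {f : C(LGConfig d G, ℝ) | 0 ≤ ∫ U, f (ΘCM U) * f U ∂μ} := by
    refine map_mem_closure (f := fun q : C(↥S → G, ℝ) => q.comp (restrictCM (G := G) S))
      (s := (polyAlgebra (ι := ↥S) r : Set C(↥S → G, ℝ)))
      (ContinuousMap.continuous_precomp (restrictCM (G := G) S)) (mem_closure_polyAlgebra r g) fun p hp => ?_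
    obtain ⟨n, hn⟩ := exists_mem_wordSpace_of_mem_halfPolyAlgebra r S (comp_restrictCM_mem_halfPolyAlgebra r S hp)
    exact hpoly n _ hn
  rw [hclosed.closure_eq] at hmem
  exact hmem

omit [Group G] [TopologicalSpace G] [IsTopologicalGroup G] [CompactSpace G] [BorelSpace G]
  [SecondCountableTopology G] [IsProbabilityMeasure μ] in
/-- ★ **Symmetry of the reflection form** for an invariant measure and an involutive reflection:
`∫ (A ∘ Θ) B dμ = ∫ (B ∘ Θ) A dμ`. -/
theorem integral_comp_mul_symm {Θ : LGConfig d G → LGConfig d G} (hΘ : MeasurePreserving Θ μ μ)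
    (hinv : ∀ U, Θ (Θ U) = U) (A B : LGConfig d G → ℝ) :
    ∫ U, A (Θ U) * B U ∂μ = ∫ U, B (Θ U) * A U ∂μ := by
  let e : LGConfig d G ≃ᵐ LGConfig d G :=
    { toFun := Θ, invFun := Θ, left_inv := hinv, right_inv := hinv,
      measurable_toFun := hΘ.measurable, measurable_invFun := hΘ.measurable }
  have h := hΘ.integral_comp e.measurableEmbedding (fun V => B (Θ V) * A V)
  simp only [hinv] at h
  rw [← h]
  refine integral_congr_ae (Eventually.of_forall fun U => ?_)
  simp only [mul_comm]

/-- ★★★ **Reflection positivity from the polynomial cuts.** `μ` a probability measure on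
`LGConfig d G`, `Θ` a continuous involution preserving `μ`: if `0 ≤ ∫ (P ∘ Θ) P dμ` for every element
`P` of every word space at `S` (the RP cuts of the bootstrap, all levels), then `μ` is reflection
positive for `(Θ, S)` in the sense of `ClassB.IsReflectionPositiveFor` (all bounded measurable
complex `S`-supported observables). [cite: OsterwalderSeiler1978, §2] -/
theorem IsReflectionPositiveFor.of_wordSpace [T2Space G] (ΘCM : C(LGConfig d G, LGConfig d G))
    (hΘ : MeasurePreserving ΘCM μ μ) (hinv : ∀ U, ΘCM (ΘCM U) = U)
    (hpoly : ∀ n, ∀ P ∈ wordSpace r S n, 0 ≤ ∫ U, P (ΘCM U) * P U ∂μ) :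
    IsReflectionPositiveFor ΘCM S μ := by
  refine IsReflectionPositiveFor.of_continuous_cylinder hΘ fun F T _ hFc _ hFS => ?_
  set A : C(LGConfig d G, ℝ) := ⟨fun U => (F U).re, Complex.continuous_re.comp hFc⟩ with hAdef
  set B : C(LGConfig d G, ℝ) := ⟨fun U => (F U).im, Complex.continuous_im.comp hFc⟩ with hBdef
  have hAS : DependsOn (⇑A) S := fun _ _ h => congrArg Complex.re (hFS h)
  have hBS : DependsOn (⇑B) S := fun _ _ h => congrArg Complex.im (hFS h)
  have hA := integral_comp_mul_self_nonneg_of_dependsOn r ΘCM hpoly hAS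
  have hB := integral_comp_mul_self_nonneg_of_dependsOn r ΘCM hpoly hBS
  have hsymm := integral_comp_mul_symm (μ := μ) hΘ hinv (⇑A) (⇑B)
  have hint : Integrable (fun U => (starRingEnd ℂ) (F (ΘCM U)) * F U) μ :=
    integrable_of_continuous_compact
      ((Complex.continuous_conj.comp (hFc.comp ΘCM.continuous)).mul hFc) μ
  have hiAA : Integrable (fun U => A (ΘCM U) * A U) μ :=
    integrable_of_continuous_compact ((A.continuous.comp ΘCM.continuous).mul A.continuous) μ
  have hiBB : Integrable (fun U => B (ΘCM U) * B U) μ :=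
    integrable_of_continuous_compact ((B.continuous.comp ΘCM.continuous).mul B.continuous) μ
  have hiAB : Integrable (fun U => A (ΘCM U) * B U) μ :=
    integrable_of_continuous_compact ((A.continuous.comp ΘCM.continuous).mul B.continuous) μ
  have hiBA : Integrable (fun U => B (ΘCM U) * A U) μ :=
    integrable_of_continuous_compact ((B.continuous.comp ΘCM.continuous).mul A.continuous) μ
  have hre : ∀ U, ((starRingEnd ℂ) (F (ΘCM U)) * F U).re = A (ΘCM U) * A U + B (ΘCM U) * B U := fun U => by
    simp only [hAdef, hBdef, ContinuousMap.coe_mk, Complex.mul_re, Complex.conj_re, Complex.conj_im]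
    ring
  have him : ∀ U, ((starRingEnd ℂ) (F (ΘCM U)) * F U).im = A (ΘCM U) * B U - B (ΘCM U) * A U := fun U => by
    simp only [hAdef, hBdef, ContinuousMap.coe_mk, Complex.mul_im, Complex.conj_re, Complex.conj_im]
    ring
  rw [Complex.nonneg_iff]
  constructor
  · have h := integral_re hint
    simp only [RCLike.re_to_complex, hre] at h
    rw [← h, integral_add hiAA hiBB]
    exact add_nonneg hA hB
  · have h := integral_im hint
    simp only [RCLike.im_to_complex, him] at h
    rw [← h, integral_sub hiAB hiBA, hsymm, sub_self]

end Density

end Summit.QuantumFields.GaugeBoot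

end
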